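import Mathlib
import HarnessLib
import Summits.HubbardSuperconductivity.HubbardSuperconductivity.Theses.WeakCouplingBCS
import Literature.MathematicalPhysics.QuantumLattice.HubbardGrandCanonicalDensity
import Summits.HubbardSuperconductivity.HubbardSuperconductivity.Theorems.WeakCouplingBCSWcbcsBcsConstructionEnergyDensityLimit
import Summits.HubbardSuperconductivity.HubbardSuperconductivity.Theorems.WeakCouplingBCSWcbcsBcsConstructionRegularEquationOfState
import Summits.HubbardSuperconductivity.HubbardSuperconductivity.Theorems.WeakCouplingBCSWcbcsBcsConstructionDensityBracketsOfFreeCounts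
import Summits.HubbardSuperconductivity.HubbardSuperconductivity.Theorems.WeakCouplingBCSWcbcsBcsConstructionFreeLevelCountsWindow

/-!
# Crux `WcbcsBcsConstruction` (stmt-HubbardSuperconductivity-2010): the crux from a window order floor and the
# absence of density jumps — the composition of line `ladder-scale-certified-chain` rev c3-1, as an importable reduction

Lead c3 (prover-line-stmt-HubbardSuperconductivity-2010-c3-0), 2026-08-17.  The skeleton of the line (crux workfile
`Cruxes/WcbcsBcsConstruction/Lines/ladder_scale_certified_chain.lean`, rev c3-1) closes the crux from three registered stubs:
(K1) certified Kohn–Luttinger `B₁g` dominance, (M) the `d`-wave order floor uniform on a chemical-potential window, (D1a) no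
density jump on `[-4/5, -7/20]` at weak coupling — plus the LANDED finite-volume inputs (D1b) `stub_freeLevelCountsWindow`,
(D1c) `stub_densityBracketsOfFreeCounts` (p138929), the reduction (D1) ⇒ (D) `stub_regularEquationOfStateOfNoDensityJump`
(p137827), the thermodynamic limit of the energy density `stub_torusGcEnergyDensityLimit` (p76736) and Griffiths' lemma
`exists_tendsto_gcDensity_of_regularWindow`.  This file lands that composition as a THEOREM with the two research statements as
hypotheses, for any order-floor window `[μ₁, μ₂] ⊇ [-4/5, -7/20]`:

* `stub_cruxOfWindowFloor` — IF (i) `∃ U₀ C > 0, ∀ U ∈ (0,U₀), ∀ μ ∈ [μ₁, μ₂], exp(-C/U²) ≤ dWaveOrderParameter U μ`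
  (the order floor, uniform on the window; by `BottomStairCostume.dbf_iff` of the crux directory this is "bottom stairs uniform on
  a μ-box") and (ii) for all small `U` the grand-canonical ground-state densities of `hubbardTorusWith 2 (L+1) 1 U ·` have no
  jump at any `ν ∈ [-4/5, -7/20]` (finite-volume form: `∀ ε > 0 ∃ h > 0`, frequently in `L`, `n_L(ν+h) - n_L(ν-h) ≤ ε`), THEN
  `WcbcsBcsConstruction` holds, with `δ = 11/50`: (ii) and the landed brackets give a `C¹` equation of state on `[-4/5,-7/20]`
  whose end slopes bracket `[1 - 7/25, 1 - 11/50]`, Darboux–Griffiths picks a density-matched `μ(U) ∈ [-4/5, -7/20]`, and (i)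
  supplies the floor there.

So the crux is REDUCED, kernel-checked, to (i) on any window containing `[-4/5, -7/20]` and (ii); the Kohn–Luttinger input (K1)
of the line is an input to PROVING (i), not to this reduction.  Nothing here proves (i) or (ii) (both are the research content:
the weak-coupling constructive BCS programme and the regularity of its equation of state).  No definitions.
References: T. Koma, H. Tasaki, J. Stat. Phys. 76 (1994) 745, §1 (the order parameter); R. B. Griffiths, J. Math. Phys. 5
(1964) 1215 (convexity ⇒ convergence of derivatives).
-/

noncomputable section

-- the tree's namespace `Summit.<Summit>.<Problem>.Theorems` repeats the summit name by design (D-0017)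
set_option linter.dupNamespace false

namespace Summit.HubbardSuperconductivity.HubbardSuperconductivity.Theorems

open Literature.MathematicalPhysics.QuantumLattice Literature.Probability.LatticeModels Filter
open scoped Topology

/-- **The crux `WcbcsBcsConstruction` from a window order floor and the absence of density jumps.**  Let
`[μ₁, μ₂] ⊇ [-4/5, -7/20]`.  If (i) there are `U₀, C > 0` with `exp(-C/U²) ≤ dWaveOrderParameter U μ` for every `U ∈ (0, U₀)` and
every `μ ∈ [μ₁, μ₂]`, and (ii) there is `U_J > 0` such that for every `U ∈ (0, U_J)` and every `ν ∈ [-4/5, -7/20]` the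
grand-canonical ground-state densities of `hubbardTorusWith 2 (L+1) 1 U ·` have no jump at `ν` (`∀ ε > 0 ∃ h > 0`, frequently in
`L`, `n_L(ν + h) - n_L(ν - h) ≤ ε`), then `WcbcsBcsConstruction`: with `δ := 11/50`, `U₀' := min U₀ U_D` and `C`, for every
`U ∈ (0, U₀')` the landed brackets (`stub_freeLevelCountsWindow`, `stub_densityBracketsOfFreeCounts`) and (ii) give, through
`stub_regularEquationOfStateOfNoDensityJump`, a differentiable limiting energy density on `[-4/5, -7/20]` with
`-e'(-4/5) ≤ 1 - 7/25 < 1 - 11/50 ≤ -e'(-7/20)`; `exists_tendsto_gcDensity_of_regularWindow` (Darboux + Griffiths, with the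
thermodynamic limit `stub_torusGcEnergyDensityLimit`) yields `μ(U) ∈ [-4/5, -7/20] ⊆ [μ₁, μ₂]` with density `→ 1 - 11/50`, and
(i) gives the floor at `μ(U)`. [cite: KomaTasaki1994, §1] -/
theorem stub_cruxOfWindowFloor :
    ∀ μ₁ μ₂ : ℝ, μ₁ ≤ -(4:ℝ) / 5 → -(7:ℝ) / 20 ≤ μ₂ →
    (∃ U₀ C : ℝ, 0 < U₀ ∧ 0 < C ∧ ∀ U ∈ Set.Ioo (0:ℝ) U₀, ∀ μ ∈ Set.Icc μ₁ μ₂,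
      Real.exp (-C / U ^ 2) ≤ dWaveOrderParameter U μ) →
    (∃ U_J : ℝ, 0 < U_J ∧ ∀ U ∈ Set.Ioo (0:ℝ) U_J, ∀ ν ∈ Set.Icc (-(4:ℝ) / 5) (-(7:ℝ) / 20), ∀ ε > 0, ∃ h > 0,
      ∃ᶠ L : ℕ in atTop,
        ((hubbardTorusWith 2 (L + 1) 1 U (ν + h)).groundStateFunctional totalNumber).re /
            ((L + 1 : ℕ) : ℝ) ^ 2 -
          ((hubbardTorusWith 2 (L + 1) 1 U (ν - h)).groundStateFunctional totalNumber).re /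
            ((L + 1 : ℕ) : ℝ) ^ 2 ≤ ε) →
    Summit.HubbardSuperconductivity.HubbardSuperconductivity.Theses.WeakCouplingBCS.WcbcsBcsConstruction := by
  intro μ₁ μ₂ hμ₁ hμ₂ hfloor hJ
  obtain ⟨U₀, C, hU₀, hC, hM⟩ := hfloor
  -- (D1a)+(D1b)+(D1c) ⇒ (D1): no density jump + end brackets, doping bracket a = 11/50, b = 7/25
  obtain ⟨U_J, hUJ, hjump⟩ := hJ
  obtain ⟨U₂, hU₂, hbr⟩ := stub_densityBracketsOfFreeCounts stub_freeLevelCountsWindow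
  have hD1 : ∃ a b : ℝ, 0 < a ∧ a < b ∧ b < 1 / 2 ∧ ∃ U_D : ℝ, 0 < U_D ∧ ∀ U ∈ Set.Ioo (0:ℝ) U_D,
      (∀ ν ∈ Set.Icc (-(4:ℝ) / 5) (-(7:ℝ) / 20), ∀ ε > 0, ∃ h > 0, ∃ᶠ L : ℕ in atTop,
        ((hubbardTorusWith 2 (L + 1) 1 U (ν + h)).groundStateFunctional totalNumber).re /
            ((L + 1 : ℕ) : ℝ) ^ 2 -
          ((hubbardTorusWith 2 (L + 1) 1 U (ν - h)).groundStateFunctional totalNumber).re /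
            ((L + 1 : ℕ) : ℝ) ^ 2 ≤ ε) ∧
      liminf (fun L : ℕ => ((hubbardTorusWith 2 (L + 1) 1 U (-(4:ℝ) / 5)).groundStateFunctional
        totalNumber).re / ((L + 1 : ℕ) : ℝ) ^ 2) atTop ≤ 1 - b ∧
      1 - a ≤ limsup (fun L : ℕ => ((hubbardTorusWith 2 (L + 1) 1 U (-(7:ℝ) / 20)).groundStateFunctional
        totalNumber).re / ((L + 1 : ℕ) : ℝ) ^ 2) atTop := by
    refine ⟨11 / 50, 7 / 25, by norm_num, by norm_num, by norm_num, min U_J U₂, lt_min hUJ hU₂, fun U hU => ?_⟩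
    have hU1 : U ∈ Set.Ioo (0:ℝ) U_J := ⟨hU.1, lt_of_lt_of_le hU.2 (min_le_left _ _)⟩
    have hU2 : U ∈ Set.Ioo (0:ℝ) U₂ := ⟨hU.1, lt_of_lt_of_le hU.2 (min_le_right _ _)⟩
    exact ⟨hjump U hU1, (hbr U hU2).1, (hbr U hU2).2⟩
  -- (D1) ⇒ (D): a C¹ equation of state on the window with bracketing end slopes
  obtain ⟨a, b, ha, hab, hb, U_D, hUD, hD⟩ := stub_regularEquationOfStateOfNoDensityJump hD1
  refine ⟨a, ⟨ha, hab.trans hb⟩, min U₀ U_D, lt_min hU₀ hUD, C, hC, fun U hU => ?_⟩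
  have hUpos : 0 < U := hU.1
  have hUU₀ : U < U₀ := lt_of_lt_of_le hU.2 (min_le_left _ _)
  have hUUD : U < U_D := lt_of_lt_of_le hU.2 (min_le_right _ _)
  -- (D): a density-matched chemical potential `μ(U)` inside `[-4/5, -7/20]`, at doping `a`
  obtain ⟨e', hder, h₁, h₂⟩ := hD U ⟨hUpos, hUUD⟩
  have h12 : (-(4:ℝ) / 5) ≤ (-(7:ℝ) / 20) := by norm_num
  have hlim : ∀ μ' : ℝ, Tendsto (fun L : ℕ => (hubbardTorusWith 2 (L + 1) 1 U μ').groundEnergy /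
      ((L + 1 : ℕ) : ℝ) ^ 2) atTop (𝓝 ((fun ν' : ℝ => limUnder atTop (fun L : ℕ =>
        (hubbardTorusWith 2 (L + 1) 1 U ν').groundEnergy / ((L + 1 : ℕ) : ℝ) ^ 2)) μ')) := fun μ' =>
    tendsto_nhds_limUnder (stub_torusGcEnergyDensityLimit U μ')
  obtain ⟨μ, hμ, hdens⟩ := exists_tendsto_gcDensity_of_regularWindow 1 U h12 hlim hder h₁ h₂
    (δ := a) ⟨le_rfl, hab.le⟩
  -- (i): the floor at `μ(U) ∈ [-4/5, -7/20] ⊆ [μ₁, μ₂]`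
  have hμ' : μ ∈ Set.Icc μ₁ μ₂ := ⟨hμ₁.trans hμ.1, hμ.2.trans hμ₂⟩
  exact ⟨μ, hdens, hM U ⟨hUpos, hUU₀⟩ μ hμ'⟩

end Summit.HubbardSuperconductivity.HubbardSuperconductivity.Theorems

end
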